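import Literature.AnabelianGeometry.SemiGraphs.SgATemperedArrows
import Literature.AnabelianGeometry.SemiGraphs.SgAToProfiniteFiniteEtale
import Literature.AnabelianGeometry.SemiGraphs.AmbientArrowClasses
import HarnessLib

/-!
# [SemiAnbd] Def 3.5 (ii) / Rmk 3.5.2: tempered arrows of `SgA` are locally finite étale (bridge law L2, proof-only)

Mochizuki, *Semi-graphs of anabelioids*, Publ. RIMS **42** (2006), §3: Def 3.5 (ii) p. 37 and
Rmk 3.5.2 p. 38 ("the construction … of a covering of semi-graphs of anabelioids associated to an
object of `B^cov(𝒢)` determines a natural full embedding of `B^cov(𝒢)` into the category of totally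
aloof, verticially slim semi-graphs of anabelioids and locally finite étale morphisms over `𝒢`"),
with Rmk 2.2.1 p. 24 ("the `Π_{v'}` … are the stabilizers") and [GeoAn] Rmk 1.2.2.1 (kurims
`paper:url-f33ace170ff4`). [cite: MochizukiSemiAnbd2006, Rmk 3.5.2, p. 38]

PROOF-ONLY (abc-iut-L3-t3 gen 5; law L2 of HOME/staging/L3/L3-t3/R1-BRIDGE-SHAPES.md §2), over
B4-def `SgATemperedArrows.lean` (`SgA.IsTemperedCoveringOf`, `ProfiniteSemiGraph.Hom.IsoOver`) and
B5 `SgAToProfiniteFiniteEtale.lean` (`isFiniteEtale_of_pi1Map_injective_of_isOpen_range`):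

* `pi1Map_φV_injective_and_isOpen_of_isoOver` / `…φE…` — at every vertex / edge of `H`, the `π₁`
  of the constituent of a 1-morphism that is isomorphic OVER `G.toProfinite` to the covering
  `G_S → G` of an object `S ∈ B^cov(G.toProfinite)` is injective with open image: after the path
  transport and an inner automorphism it is `Π_{H,w} ⥲ Stab(x_ω) ↪ Π_{G, f w}`, and stabilisers of
  objects of `B^temp(Π)` are open (`temperedAction`);
* `isLocallyFiniteEtale_of_isoOver` — hence such a 1-morphism is locally finite étale (t1's
  `Hom.IsLocallyFiniteEtale`);
* **`locallyFiniteEtale_of_isTemperedCoveringOf`** — THE LAW `locallyFiniteEtale_of_isTempered` of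
  `SgA.TemperedResidual` / `SgA.BridgeResidual` for the honest `IsTemperedCoveringOf`:
  `IsTemperedCoveringOf f → locallyFiniteEtale f.hom.hom`.

Remaining for `SgA.TemperedResidual.real` (hence the parameter-free §§4–5 container): law L1
(finite étale ⇒ tempered).  Nothing of the paper beyond the cited definitions is used; no side taken
on [IUTchIII] Cor. 3.12.
-/

noncomputable section

namespace Literature.AnabelianGeometry.SemiGraphs

open CategoryTheory CategoryTheory.Limits CategoryTheory.PreGaloisCategory
open Literature.AnabelianGeometry.Anabelioids
open scoped Pointwise

universe u

/-! ### Topological-group bookkeeping -/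

section GroupLemmas

variable {K : Type*} [Group K] [TopologicalSpace K] [IsTopologicalGroup K]

/-- Conjugation by a fixed element maps open sets to open sets. [folklore] -/
private theorem isOpen_image_conj (g : K) {S : Set K} (hS : IsOpen S) :
    IsOpen ((fun y => g * y * g⁻¹) '' S) := by
  have h : (fun y => g * y * g⁻¹) '' S = (Homeomorph.mulRight g⁻¹) '' ((Homeomorph.mulLeft g) '' S) := by
    rw [← Set.image_comp]; rfl
  rw [h]
  exact (Homeomorph.mulRight g⁻¹).isOpenMap _ ((Homeomorph.mulLeft g).isOpenMap _ hS)

end GroupLemmas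

namespace SgAQuot.SgA

open SemiGraphOfAnabelioids ProfiniteSemiGraph

variable {H G : SgA.{u, u, u}}

/-! ### The `π₁` of the constituents of a tempered arrow: injective with open image -/

/-- If a homomorphism `m` becomes, after an isomorphism of topological groups `T` and up to
conjugation, a map `ψ` that is injective with open image, then `m` is injective with open image.
[folklore] -/
private theorem injective_and_isOpen_range_of_conj {A B : Type u} [Group A] [Group B]
    [TopologicalSpace A] [TopologicalSpace B] [IsTopologicalGroup B]
    (m : A → B) {B' : Type u} [Group B'] [TopologicalSpace B'] [IsTopologicalGroup B']
    (T : B ≃ₜ* B') (ψ : A → B') (g : B') (hψinj : Function.Injective ψ)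
    (hψopen : IsOpen (Set.range ψ)) (h : ∀ x, ψ x = g * T (m x) * g⁻¹) :
    Function.Injective m ∧ IsOpen (Set.range m) := by
  have hm : ∀ x, m x = T.symm (g⁻¹ * ψ x * g) := fun x => by
    apply T.injective
    rw [ContinuousMulEquiv.apply_symm_apply, h x]
    group
  refine ⟨fun x y hxy => hψinj ?_, ?_⟩
  · rw [h x, h y, hxy]
  · have hr : Set.range m = T.symm '' ((fun y => g⁻¹ * y * g⁻¹⁻¹) '' Set.range ψ) := by
      ext z
      simp only [Set.mem_image, Set.mem_range, exists_exists_eq_and, inv_inv]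
      constructor
      · rintro ⟨x, rfl⟩; exact ⟨x, (hm x).symm⟩
      · rintro ⟨x, rfl⟩; exact ⟨x, hm x⟩
    rw [hr]
    exact T.symm.toHomeomorph.isOpenMap _ (isOpen_image_conj g⁻¹ hψopen)

/-- **The vertex constituents of a tempered arrow have `π₁` injective with open image**: at a vertex
`w` of `H`, `π₁(φ_w^*) : Π_{H,w} → Aut(φ_w^* ⋙ F_{H,w})` is — after the path transport and up to an
inner automorphism of `Π_{G, f w}` — the composite `Π_{H,w} ⥲ Stab(x_ω) ↪ Π_{G, f w}` of the
isomorphism over `G.toProfinite` with the open stabiliser inclusion of the covering graph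
(Rmk 2.2.1: "the `Π_{v'}` are the stabilizers"). [cite: MochizukiSemiAnbd2006, Rem. 2.2.1 p.24] -/
theorem pi1Map_φV_injective_and_isOpen_of_isoOver (f : H ⟶ G)
    (φ : HomOver H.toSgA G.toSgA f.hom.hom.base) (S : CovObj G.toSgA.toProfinite)
    (I : ProfiniteSemiGraph.Hom.IsoOver φ.toProfinite S.coveringHom) (w : H.toSgA.graph.Vertex) :
    Function.Injective (pi1Map (φ.φV w).pullback (H.toSgA.fibV w)) ∧
      IsOpen (Set.range (pi1Map (φ.φV w).pullback (H.toSgA.fibV w))) := by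
  obtain ⟨g, hg⟩ := I.hV_comm w
  -- the target-side map: iso, stabiliser inclusion, transport
  have c₀ : S.coveringHom.base.vertexMap (I.iso.base.vertexMap w) =
      φ.toProfinite.base.vertexMap w := by
    rw [← I.base_comm]; rfl
  have c : (I.iso.base.vertexMap w).1 = f.hom.hom.base.vertexMap w := c₀
  let ψ : Aut (H.toSgA.fibV w) → Aut (G.toSgA.fibV (f.hom.hom.base.vertexMap w)) := fun x =>
    G.toSgA.toProfinite.castGv c (I.iso.hV w x).1
  have hψinj : Function.Injective ψ := by
    intro x y hxy
    have h1 := (G.toSgA.toProfinite.castGv c).injective hxy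
    have h2 : I.iso.hV w x = I.iso.hV w y := Subtype.ext h1
    exact (I.isLocallyTrivial.1 w).1 h2
  have hψopen : IsOpen (Set.range ψ) := by
    have hr : Set.range ψ = G.toSgA.toProfinite.castGv c ''
        ((BTemp.stab (S.SV (I.iso.base.vertexMap w).1) (Quot.out (I.iso.base.vertexMap w).2) :
          Subgroup (G.toSgA.toProfinite.Gv (I.iso.base.vertexMap w).1)) :
          Set (G.toSgA.toProfinite.Gv (I.iso.base.vertexMap w).1)) := by
      ext z
      constructor
      · rintro ⟨x, rfl⟩
        exact ⟨_, (I.iso.hV w x).2, rfl⟩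
      · rintro ⟨y, hy, rfl⟩
        obtain ⟨x, hx⟩ := (I.isLocallyTrivial.1 w).2 ⟨y, hy⟩
        exact ⟨x, by simp only [ψ, hx]⟩
    rw [hr]
    exact (G.toSgA.toProfinite.castGv c).toHomeomorph.isOpenMap _
      ((S.SV (I.iso.base.vertexMap w).1).property.2 _)
  refine injective_and_isOpen_range_of_conj (pi1Map (φ.φV w).pullback (H.toSgA.fibV w))
    (Aut.continuousMulEquivOfIso (φ.vertexPath w)) ψ g hψinj hψopen fun x => ?_
  have := hg x
  exact this

/-- **The edge constituents of a tempered arrow have `π₁` injective with open image** (as for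
vertices, with the edge stabilisers). [cite: MochizukiSemiAnbd2006, Rem. 2.2.1 p.24] -/
theorem pi1Map_φE_injective_and_isOpen_of_isoOver (f : H ⟶ G)
    (φ : HomOver H.toSgA G.toSgA f.hom.hom.base) (S : CovObj G.toSgA.toProfinite)
    (I : ProfiniteSemiGraph.Hom.IsoOver φ.toProfinite S.coveringHom) (e : H.toSgA.graph.Edge) :
    Function.Injective
        (pi1Map (φ.φE e (f.hom.hom.base.edgeMap e) rfl).pullback (H.toSgA.fibE e)) ∧
      IsOpen (Set.range
        (pi1Map (φ.φE e (f.hom.hom.base.edgeMap e) rfl).pullback (H.toSgA.fibE e))) := by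
  obtain ⟨g, hg⟩ := I.hE_comm e
  have c₀ : S.coveringHom.base.edgeMap (I.iso.base.edgeMap e) = φ.toProfinite.base.edgeMap e := by
    rw [← I.base_comm]; rfl
  have c : (I.iso.base.edgeMap e).1 = f.hom.hom.base.edgeMap e := c₀
  let ψ : Aut (H.toSgA.fibE e) → Aut (G.toSgA.fibE (f.hom.hom.base.edgeMap e)) := fun x =>
    G.toSgA.toProfinite.castGe c (I.iso.hE e x).1
  have hψinj : Function.Injective ψ := by
    intro x y hxy
    have h1 := (G.toSgA.toProfinite.castGe c).injective hxy
    have h2 : I.iso.hE e x = I.iso.hE e y := Subtype.ext h1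
    exact (I.isLocallyTrivial.2 e).1 h2
  have hψopen : IsOpen (Set.range ψ) := by
    have hr : Set.range ψ = G.toSgA.toProfinite.castGe c ''
        ((BTemp.stab (S.SE (I.iso.base.edgeMap e).1) (Quot.out (I.iso.base.edgeMap e).2) :
          Subgroup (G.toSgA.toProfinite.Ge (I.iso.base.edgeMap e).1)) :
          Set (G.toSgA.toProfinite.Ge (I.iso.base.edgeMap e).1)) := by
      ext z
      constructor
      · rintro ⟨x, rfl⟩
        exact ⟨_, (I.iso.hE e x).2, rfl⟩
      · rintro ⟨y, hy, rfl⟩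
        obtain ⟨x, hx⟩ := (I.isLocallyTrivial.2 e).2 ⟨y, hy⟩
        exact ⟨x, by simp only [ψ, hx]⟩
    rw [hr]
    exact (G.toSgA.toProfinite.castGe c).toHomeomorph.isOpenMap _
      ((S.SE (I.iso.base.edgeMap e).1).property.2 _)
  refine injective_and_isOpen_range_of_conj
    (pi1Map (φ.φE e (f.hom.hom.base.edgeMap e) rfl).pullback (H.toSgA.fibE e))
    (Aut.continuousMulEquivOfIso (φ.edgePath e (f.hom.hom.base.edgeMap e) rfl)) ψ g hψinj hψopen
    fun x => ?_
  have := hg x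
  exact this

/-! ### Law (R1b): tempered ⇒ locally finite étale -/

/-- A 1-morphism isomorphic over `G.toProfinite` to the covering of an object of `B^cov` is locally
finite étale: every `π₁(φ_c^*)` is injective with open image (previous lemmas), hence `φ_c` is finite
étale ([GeoAn] Rmk 1.2.2.1 for abstract anabelioids, B5 `isFiniteEtale_of_pi1Map_injective_of_isOpen_range`).
[cite: MochizukiSemiAnbd2006, Rmk 3.5.2, p. 38] -/
theorem isLocallyFiniteEtale_of_isoOver (f : H ⟶ G) (φ : HomOver H.toSgA G.toSgA f.hom.hom.base)
    (S : CovObj G.toSgA.toProfinite)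
    (I : ProfiniteSemiGraph.Hom.IsoOver φ.toProfinite S.coveringHom) :
    φ.toHom.IsLocallyFiniteEtale := by
  refine ⟨fun w => ?_, fun e => ?_⟩
  · obtain ⟨hinj, hopen⟩ := pi1Map_φV_injective_and_isOpen_of_isoOver f φ S I w
    exact isFiniteEtale_of_pi1Map_injective_of_isOpen_range (φ.φV w).pullback (H.toSgA.fibV w)
      hinj hopen
  · obtain ⟨hinj, hopen⟩ := pi1Map_φE_injective_and_isOpen_of_isoOver f φ S I e
    exact isFiniteEtale_of_pi1Map_injective_of_isOpen_range
      (φ.φE e (f.hom.hom.base.edgeMap e) rfl).pullback (H.toSgA.fibE e) hinj hopen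

/-- **Def 3.5 (ii) with Rmk 3.5.2: TEMPERED ARROWS OF `SgA` ARE LOCALLY FINITE ÉTALE** — the law
`locallyFiniteEtale_of_isTempered` of the residual `SgA.TemperedResidual` / `SgA.BridgeResidual`,
PROVED for the honest `IsTemperedCoveringOf` (B4): the constituents of a tempered covering are the
open stabiliser inclusions `Stab(x) ↪ Π_c` of the covering graph, read back through the bridge.
[cite: MochizukiSemiAnbd2006, Rmk 3.5.2, p. 38] -/
theorem locallyFiniteEtale_of_isTemperedCoveringOf (f : H ⟶ G) (h : IsTemperedCoveringOf f) :
    locallyFiniteEtale f.hom.hom := by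
  obtain ⟨S, -, ⟨I⟩⟩ := h
  rw [← homMk_repHomOver f]
  exact (homMk_mem_locallyFiniteEtale_iff (repHomOver f)).mpr
    (isLocallyFiniteEtale_of_isoOver f (repHomOver f) S I)

end SgAQuot.SgA

end Literature.AnabelianGeometry.SemiGraphs

end
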